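import Summits.QuantumFields.YangMills.Theorems.BalabanUVNodesN15TwoSpacingGluingCurvedKnit
import Summits.QuantumFields.YangMills.Theorems.BalabanUVNodesN15CurvedLocalCoefLettersOfReg335UN
import HarnessLib

/-!
# THE GLUING STEP AT TWO LATTICE SPACINGS — (Γ15) THE LIVE-`U` KNIT AT THE COVER, VIII: THE PER-CUBE GAUGES AND THEIR (3.35) LETTERS FROM BAŁABAN's REGULARITY CLASS BY NAME —
# FILE 120's displayed rows `hu`, `hCloc`, `hAloc` DISCHARGED by dag-n15-w2's `uN_exists_gauge_cutCoefLetters_of_reg335Cube` from ONE `Reg335Cube` datum per cube (dag-n15-c g15, FILE 125;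
# N15 = NE2, s1 «background-layer OPERATOR ingredient»)

Cell `pub-ymgap`, seat `pub-ymgap-dag-n15-c` (R134 (a); HUMAN RULING D-0062), generation 15.  `bears_on: R4∕N15 · K3⁸ SpineGivenEndpointR13SepCoPHV (stmt-QuantumFields-27366)`.
Filed `--kind proof --supports stmt-QuantumFields-27366 --as helper` — COUNT-NEUTRAL.  One theorem; 0 `def`, 0 `sorry`.  Imports BY NAME FILE 120 `…TwoSpacingGluingCurvedKnit` (`uN_cvGlued_spec`) and
dag-n15-w2 g6 `…CurvedLocalCoefLettersOfReg335UN` (`uN_exists_gauge_cutCoefLetters_of_reg335Cube`; through it lit-balaban r06 `B9Eq335RegularityClasses.Reg335Cube` = [B9] (3.35) on a cube,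
`B9Eq3117Current.gaugeTr`, `B9Eq39Adjoint.fluct`).  Nothing in the tree is modified.

WHAT.  ★★★ `uN_cvGlued_spec_of_reg335Cube` — FILE 120 with the per-cube unitary gauges PRODUCED instead of displayed: for a `U(m)`-valued bond field `U` on the cover's torus which is, on
a set `Q_k ⊇` (one-step neighbourhood of the cut box `χ_k ≠ 0`) of every cube, IN BAŁABAN's CLASS (3.35) `Reg335Cube (bshiftEquiv M (L^k)) U η Q_k ξ C` (∃ gauge `u`, `U^u = e^{iηA}`,
`|A| < C∕ξ`, `|∇^ηA| < C∕ξ²` on `Q_k`), dag-n15-w2's theorem gives gauges `w_k` UNITARY EVERYWHERE (the class's gauge on `Q_k`, `1` off it) with the (3.35) row letters of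
`tCoefC`∕`tCoefA` of the transformed bond variables `w_kUw_kᴴ` where `χ_k ≠ 0`, bounded by `r_V` as soon as `r_V` dominates the two explicit bounds (displayed: `κ_e·2√m·√m·(C∕ξ)e^{ηC∕ξ}`
and its square companion); FILE 120 then yields, FOR THESE GAUGES, the decay and the two-sided inverse of the glued operator `cvGlued … w U P N_V` of Bałaban's `Δ_{R_U} + P` — with ONLY
the conjugation law of `P` in the gauges `w_k` and `N_V`'s cut∕far letters still displayed (the lane's objects, [B9] (3.49)∕(3.68)∕(3.77)).

HONEST FRAMING ∕ LIMITS.  One `choose` + two applications; the class (3.35) per cube is the HYPOTHESIS (as in [B9] Thm 3.1 ∕ Cor. 3.6: «for U in the class»), on user-chosen sets `Q_k`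
whose interior condition w.r.t. the cut box is displayed (`hQ`); constants crude; MODEL carriers (finite doubled torus, flat cubes by images, abstract `P`, `N_V`); the SHAPE of [B9] Thm 3.1, not
the printed theorem; nothing of [B5]∕[B6]∕[B9] asserted.  NE2⁺ NOT PRINTED, NOT proved; N15 NOT discharged; K3⁸ OPEN, skeleton v6 untouched; counts of record UNMOVED (typed 28∕28 ·
discharged 5∕27); one finite 𝕋⁴ at fixed ε — NOT infinite volume, NOT OS on ℝ⁴, NOT a mass gap, NOT Clay; R4 closes the conditional finite-𝕋⁴ rung `BalabanLadder.UV` only.  Restate-immune.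
-/

noncomputable section

open scoped BigOperators Matrix Matrix.Norms.L2Operator

namespace Summit.QuantumFields.YangMills.BalabanUVNodes.N15.Gluing

open Real
open Literature.MathematicalPhysics.QuantumFieldTheory.Balaban1983to89
open Literature.MathematicalPhysics.QuantumFieldTheory.Balaban1983to89.B11SectG (BlockNorm HasMaj)
open Literature.MathematicalPhysics.QuantumFieldTheory.Balaban1983to89.B6Prop26Gluing (mulOp)
open Literature.MathematicalPhysics.QuantumFieldTheory.Balaban1983to89.B6UnitTorusCarrier (unitTorusGeo)
open Literature.MathematicalPhysics.QuantumFieldTheory.Balaban1983to89.B9Eq335RegularityClasses (Reg335Cube)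
open Literature.Barriers.QuantumFields (traceForm)
open Summit.QuantumFields.YangMills.BalabanUVNodes.N15.BackgroundLayer (covLapM tCoefA tCoefC)
open Summit.QuantumFields.YangMills.BalabanUVNodes.N15.VectorPiece (bshiftEquiv)
open Summit.QuantumFields.YangMills.BalabanUVNodes.N15.MatrixSpecies (mmulOp coordMat basisConst)
open Summit.QuantumFields.YangMills.BalabanUVNodes.N15.CurvedSpecies (gaugePair uN_exists_gauge_cutCoefLetters_of_reg335Cube)

variable {d : ℕ}

section Reg335

variable {L : ℕ} [NeZero L]

/-- ★★★ **THE LIVE-`U` KNIT AT THE COVER FOR A BACKGROUND IN BAŁABAN's CLASS (3.35) PER CUBE** (FILE 120 `uN_cvGlued_spec` + dag-n15-w2 `uN_exists_gauge_cutCoefLetters_of_reg335Cube`):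
for odd `L ≥ 7`, `a > 0`, a colour index `ι` there are `δ, w₀, R₀, θ₀, B > 0` (FILE 120's) such that on every doubled torus `2L·L^m` of the cover (`k ≥ 1`, `L^m ≥ w₀`), for trace-form
coordinates `e` of `𝔲(m)` (`m ≥ 1`), every `U(m)`-valued bond field `U` which on sets `Q_k` containing the one-step neighbourhood of each cut box is in the class
`Reg335Cube (bshiftEquiv M (L^k)) U L^{−k} Q_k ξ C` (`ξ > 0`, `C ≥ 0`), and every `r_V` dominating the two displayed explicit bounds with `r_V(1+|J⊕J|) + R_N ≤ R₀`, `θ_F ≤ θ₀`: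
THERE ARE per-cube site gauges `w_k`, UNITARY EVERYWHERE, such that for every summand `P` with the conjugation law `M_{W_k}PM_{W_kᵀ} = N_L ⊗ 1 − N_V k` in these gauges and every `N_V`
with the cut letter `R_N` and far letter `θ_F` at rate `δ`, the glued operator `cvGlued … w U P N_V` is `≤ B·e^{−(δ∕16)|y−y′|_T}` blockwise and is the two-sided inverse of
`Δ_{R_U} + P` — FILE 120's `hu`, `hCloc`, `hAloc` rows PRODUCED from (3.35).  MODEL carriers; NOT [B9] Thm 3.1 as printed.
[cite: Balaban1985BackgroundPropagators, Thm 3.1 p.397 («for U satisfying (3.34)–(3.35)»: shape), (3.34)–(3.35) p.396, Cor. 3.6 p.408, (3.62)–(3.65) pp.402–403; Balaban1984PropagatorsII, (2.91)–(2.93) p.239] -/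
theorem uN_cvGlued_spec_of_reg335Cube (hL : Odd L ∧ 1 < L) (hL7 : 7 ≤ L) {a : ℝ} (ha : 0 < a) (ι : Type) [Fintype ι] [DecidableEq ι] :
    ∃ δ w₀ R₀ θ₀ B : ℝ, 0 < δ ∧ 0 < R₀ ∧ 0 < θ₀ ∧ 0 < B ∧
      ∀ (mv kk : ℕ), 1 ≤ kk → w₀ ≤ ((L ^ mv : ℕ) : ℝ) →
      ∀ {mm : Type} [Fintype mm] [DecidableEq mm] [Nonempty mm] (e : Matrix mm mm ℂ ≃L[ℝ] (ι → ℝ)), (∀ A B : Matrix mm mm ℂ, traceForm A B = e A ⬝ᵥ e B) →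
      ∀ (U : Fin (d + 1) → CvX d L mv kk hL → (Matrix mm mm ℂ)ˣ), (∀ μ x, (U μ x : Matrix mm mm ℂ) ∈ Matrix.unitaryGroup mm ℂ) →
      ∀ (Q : (Fin (d + 1) → ZMod (2 * L)) → Set (CvX d L mv kk hL)) (ξ C : ℝ), 0 < ξ → 0 ≤ C →
        (∀ k, Reg335Cube (bshiftEquiv (cvM d L mv kk hL) (L ^ kk)) U ((((L ^ kk : ℕ) : ℝ))⁻¹) (Q k) ξ C) →
        (∀ k x, cvChi d L mv kk hL k x ≠ 0 → x ∈ Q k ∧ (∀ μ, bshiftEquiv (cvM d L mv kk hL) (L ^ kk) μ x ∈ Q k) ∧ (∀ μ, (bshiftEquiv (cvM d L mv kk hL) (L ^ kk) μ).symm x ∈ Q k)) →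
      ∀ (rV RN θF : ℝ), 0 ≤ rV → 0 ≤ RN → 0 ≤ θF →
        Fintype.card ι * (@basisConst ι _ (Matrix mm mm ℂ) Matrix.frobeniusNormedAddCommGroup Matrix.frobeniusNormedSpace e * (2 * Real.sqrt (Fintype.card mm)) * (Real.sqrt (Fintype.card mm) * ((C / ξ) * Real.exp (((((L ^ kk : ℕ) : ℝ))⁻¹) * (C / ξ))))) ≤ rV →
        Fintype.card ι * (Fintype.card (Fin (d + 1)) * (Fintype.card ι * (@basisConst ι _ (Matrix mm mm ℂ) Matrix.frobeniusNormedAddCommGroup Matrix.frobeniusNormedSpace e * (2 * Real.sqrt (Fintype.card mm)) * (Real.sqrt (Fintype.card mm) * ((C / ξ) * Real.exp (((((L ^ kk : ℕ) : ℝ))⁻¹) * (C / ξ))))) ^ 2 + @basisConst ι _ (Matrix mm mm ℂ) Matrix.frobeniusNormedAddCommGroup Matrix.frobeniusNormedSpace e * (2 * Real.sqrt (Fintype.card mm)) * (Real.sqrt (Fintype.card mm) * ((C / ξ ^ 2) * Real.exp (((((L ^ kk : ℕ) : ℝ))⁻¹) * (C / ξ)))))) ≤ rV →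
        rV * (1 + Fintype.card (Fin (d + 1) ⊕ Fin (d + 1))) + RN ≤ R₀ → θF ≤ θ₀ →
      ∃ w : (Fin (d + 1) → ZMod (2 * L)) → CvX d L mv kk hL → Matrix mm mm ℂ, (∀ k x, (w k x)ᴴ * w k x = 1) ∧
        ∀ (P : (CvX d L mv kk hL × ι → ℝ) →ₗ[ℝ] (CvX d L mv kk hL × ι → ℝ)) (NV : (Fin (d + 1) → ZMod (2 * L)) → (CvX d L mv kk hL × ι → ℝ) →ₗ[ℝ] (CvX d L mv kk hL × ι → ℝ)),
        (∀ k, mmulOp (fun x => coordMat e (ContinuousLinearMap.mulLeftRight ℝ (Matrix mm mm ℂ) (w k x) (w k x)ᴴ)) ∘ₗ P ∘ₗ mmulOp (fun x => (coordMat e (ContinuousLinearMap.mulLeftRight ℝ (Matrix mm mm ℂ) (w k x) (w k x)ᴴ))ᵀ) = (cvNL d L mv kk hL a ι) - NV k) →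
        (∀ k, HasMaj (CvNorm d L mv kk hL ι) (CvNorm d L mv kk hL ι) (mulOp (fun p : CvX d L mv kk hL × ι => cvPsi d L mv kk hL k p.1) ∘ₗ NV k ∘ₗ mulOp (fun p : CvX d L mv kk hL × ι => cvChi d L mv kk hL k p.1)) (fun y y' => RN * Real.exp (-(δ * (unitTorusGeo L kk (cvM d L mv kk hL)).dist y y')))) →
        (∀ k, HasMaj (CvNorm d L mv kk hL ι) (CvNorm d L mv kk hL ι) ((LinearMap.id - mulOp (fun p : CvX d L mv kk hL × ι => cvPsi d L mv kk hL k p.1)) ∘ₗ NV k ∘ₗ mulOp (fun p : CvX d L mv kk hL × ι => cvChi d L mv kk hL k p.1)) (fun y y' => θF * Real.exp (-(δ * (unitTorusGeo L kk (cvM d L mv kk hL)).dist y y')))) →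
                HasMaj (CvNorm d L mv kk hL ι) (CvNorm d L mv kk hL ι) (cvGlued d L mv kk hL a ((((L ^ kk : ℕ) : ℝ))⁻¹) ι e w (fun μ x => (U μ x : Matrix mm mm ℂ)) P NV)
          (fun y y' => B * Real.exp (-(δ / 16 * (unitTorusGeo L kk (cvM d L mv kk hL)).dist y y'))) ∧
        (cvGlued d L mv kk hL a ((((L ^ kk : ℕ) : ℝ))⁻¹) ι e w (fun μ x => (U μ x : Matrix mm mm ℂ)) P NV ∘ₗ (covLapM (bshiftEquiv (cvM d L mv kk hL) (L ^ kk)) ((((L ^ kk : ℕ) : ℝ))⁻¹) (gaugePair (bshiftEquiv (cvM d L mv kk hL) (L ^ kk)) (fun μ x => coordMat e (ContinuousLinearMap.mulLeftRight ℝ (Matrix mm mm ℂ) (U μ x : Matrix mm mm ℂ) (U μ x : Matrix mm mm ℂ)ᴴ))) + P) = LinearMap.id ∧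
          (covLapM (bshiftEquiv (cvM d L mv kk hL) (L ^ kk)) ((((L ^ kk : ℕ) : ℝ))⁻¹) (gaugePair (bshiftEquiv (cvM d L mv kk hL) (L ^ kk)) (fun μ x => coordMat e (ContinuousLinearMap.mulLeftRight ℝ (Matrix mm mm ℂ) (U μ x : Matrix mm mm ℂ) (U μ x : Matrix mm mm ℂ)ᴴ))) + P) ∘ₗ cvGlued d L mv kk hL a ((((L ^ kk : ℕ) : ℝ))⁻¹) ι e w (fun μ x => (U μ x : Matrix mm mm ℂ)) P NV = LinearMap.id) := by
  obtain ⟨δ, w₀, R₀, θ₀, B, hδ, hR₀, hθ₀, hB, H⟩ := uN_cvGlued_spec (d := d) hL hL7 ha ι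
  refine ⟨δ, w₀, R₀, θ₀, B, hδ, hR₀, hθ₀, hB, fun mv kk hk hw₀ => ?_⟩
  intro mm _ _ _ e he U hU Q ξ C hξ hC h335 hQ rV RN θF hrV hRN hθF hrA hrC hRle hθle
  have hη : (0 : ℝ) < (((L ^ kk : ℕ) : ℝ))⁻¹ := inv_pos.mpr (Nat.cast_pos.mpr (pow_pos (Nat.pos_of_ne_zero (NeZero.ne L)) kk))
  choose w hwu hwC hwA using fun k => uN_exists_gauge_cutCoefLetters_of_reg335Cube e (bshiftEquiv (cvM d L mv kk hL) (L ^ kk)) U he hη hU hξ hC (h335 k) (hQ k) hrA hrC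
  refine ⟨w, fun k x => hwu k x, fun P NV hP hNVcut hfarN => ?_⟩
  exact H mv kk hk hw₀ e he w (fun k x => hwu k x) (fun μ x => (U μ x : Matrix mm mm ℂ)) P NV rV RN θF hrV hRN hθF hRle hθle hP (fun k => hwC k) (fun k => hwA k) hNVcut hfarN

end Reg335

end Summit.QuantumFields.YangMills.BalabanUVNodes.N15.Gluing

end
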